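import Mathlib
import HarnessLib
import Literature.MathematicalPhysics.QuantumLattice.GaugeGroups
import Literature.MathematicalPhysics.QuantumFieldTheory.ConstructiveQFTWave0
import Literature.MathematicalPhysics.QuantumFieldTheory.U1GinibreComparison
import Literature.MathematicalPhysics.QuantumFieldTheory.GaussianToolkit
import Summits.Ventures.LatticeQCDFlow.Exactness.CompactHaar
import Summits.Ventures.LatticeQCDFlow.Scaling.HaarConvolutionRatio
import Summits.Ventures.LatticeQCDFlow.Scaling.PlaquetteIndependence2D
import Summits.Ventures.LatticeQCDFlow.Scaling.PlaquetteMarginals2D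
import Summits.Ventures.LatticeQCDFlow.Scaling.LatticePeeling
import Summits.Ventures.LatticeQCDFlow.Scaling.FluxTunnellingU1Explicit
import Summits.Ventures.LatticeQCDFlow.Scaling.ConvolutionPowerCompensation

/-!
# The 2-d `U(1)` Wilson measure of a patch event is at least the PRODUCT law's, up to a volume-vanishing factor

HONEST FRAMING: exact (Metropolis-corrected) sampling algorithms for lattice gauge theory;
figures of merit are autocorrelation/cost numbers at stated couplings and volumes; no
continuum-physics claim.

Venture `LatticeQCDFlow` (cell pub-lqcd), topic `Scaling`, FANOUT row 29 (theory2, gen-20), item 102.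
NEW WORK over lean-1's exact plaquette-marginal formula (`Scaling/PlaquetteMarginals2D`, row 30) and
item 101 (`ConvolutionPowerCompensation`); nothing here is cited as a fact.

lean-1's `u1_pow_mul_lintegral_le` bounds the Wilson expectation of a patch observable from ABOVE by
the product of one-plaquette laws (`z₁^{n+#P}·∫ f dμ ≤ ∫ f·∏_P w dHaar^Λ`, even `L`).  This file is the
LOWER companion, for EVERY `L` (no parity hypothesis) and every patch `P` with `#P + 3 ≤ L²`:

* **`u1_lintegral_patch_ge`** — for `β ≥ 0` and `f ≥ 0` measurable depending only on the plaquettes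
  in `P`,
  `e^{−β(L²−#P)(1 − cos(π/(L²−#P−1)))} · ∫ f(g)·∏_{x∈P} w_β(g_x) dHaar^{⊗Λ}(g) ≤ z₁(β)^{#P} · ∫ f(U_·) dμ_{β,L}`,
  i.e. the Wilson law of the patch dominates the product of one-plaquette laws `w_β dHaar/z₁` up to
  the factor `ρ_{L,#P}(β) = e^{−β(L²−#P)(1−cos(π/(L²−#P−1)))} = e^{−βπ²/(2(L²−#P))·(1+o(1))} → 1` as the
  volume grows at fixed `β` (`lintegral_prod_u1W_eq_pow`: the product integral is `z₁^{#P}`);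
* `u1_measure_patch_ge` — the same for events.

Proof: lean-1's puncture formula `∫ f(U_·)∏_x w(U_x) dHaar^E = ∫ f·∏_P w·(K^{m} w)(∏_P g) dHaar^Λ`
(`m = L² − 1 − #P`) for the numerator AND for `Z` (with `f = 1` and the same `P`), and item 101's
two-sided level `ρ·s ≤ K^m w ≤ s`: the unknown level `s` cancels in the ratio.  Elementary; no `def`.
-/

noncomputable section

namespace Summit.Ventures.LatticeQCDFlow.Theory2.Lattice.TwoDim

open MeasureTheory Literature.MathematicalPhysics.QuantumFieldTheory
open Literature.MathematicalPhysics.QuantumLattice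
open Summit.Ventures.LatticeQCDFlow.Theory2.HaarConv
open scoped ENNReal

variable {L : ℕ}

/-- `∫ ∏_{x∈P} w_β(g_x) dHaar^{⊗Λ}(g) = z₁(β)^{#P}`. [folklore] -/
theorem lintegral_prod_u1W_eq_pow [NeZero L] (β : ℝ) (P : Finset (Site 2 L)) :
    ∫⁻ g, ∏ x ∈ P, u1W β (g x) ∂(Measure.pi fun _ : Site 2 L => haarProbability Circle) =
      z1 u1Rep β ^ P.card := by
  classical
  have hF : ∀ i : Site 2 L, Measurable fun y : Circle => if i ∈ P then u1W β y else 1 := by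
    intro i; split_ifs
    · exact measurable_u1W β
    · exact measurable_const
  have h1 : (fun g : Site 2 L → Circle => ∏ x ∈ P, u1W β (g x)) =
      fun g => ∏ i, (fun i y => if i ∈ P then u1W β y else (1 : ℝ≥0∞)) i (g i) := by
    funext g; simp only; rw [Fintype.prod_extend_by_one]
  rw [h1, GaussianToolkit.lintegral_fintype_prod_eq_prod (fun _ : Site 2 L => haarProbability Circle) hF]
  have h2 : ∀ i : Site 2 L, (∫⁻ y, (if i ∈ P then u1W β y else (1 : ℝ≥0∞)) ∂(haarProbability Circle)) =
      if i ∈ P then z1 u1Rep β else 1 := by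
    intro i; split_ifs
    · exact (z1_eq_lintegral_u1W β).symm
    · rw [lintegral_const, measure_univ, one_mul]
  simp_rw [h2]
  rw [Fintype.prod_extend_by_one, Finset.prod_const]

/-- **THE WILSON LAW OF A PATCH DOMINATES THE PRODUCT LAW** (2-d `U(1)`, every `L`, `β ≥ 0`,
`#P + 3 ≤ L²`): for `f ≥ 0` measurable depending only on the plaquettes in `P`,
`e^{−β(L²−#P)(1−cos(π/(L²−#P−1)))}·∫ f·∏_{x∈P} w_β(g_x) dHaar^{⊗Λ} ≤ z₁(β)^{#P}·∫ f(U_·) dμ_{β,L}`. [folklore] -/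
theorem u1_lintegral_patch_ge [NeZero L] (hL : 2 ≤ L) {β : ℝ} (hβ : 0 ≤ β) (P : Finset (Site 2 L))
    (hP : P.card + 3 ≤ L ^ 2) {f : (Site 2 L → Circle) → ℝ≥0∞} (hfm : Measurable f)
    (hf : ∀ g g' : Site 2 L → Circle, (∀ x ∈ P, g x = g' x) → f g = f g') :
    ENNReal.ofReal (Real.exp (-(β * (((L ^ 2 - P.card : ℕ) : ℝ) *
        (1 - Real.cos (Real.pi / ((L ^ 2 - P.card - 1 : ℕ) : ℝ))))))) *
      ∫⁻ g, f g * ∏ x ∈ P, u1W β (g x) ∂(Measure.pi fun _ : Site 2 L => haarProbability Circle) ≤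
    z1 u1Rep β ^ P.card *
      ∫⁻ U, f (fun x => plaquetteHolonomy U x 0 1) ∂(wilsonMeasure (d := 2) (L := L) u1Rep β) := by
  classical
  have hw : Measurable (u1W β) := measurable_u1W β
  have hws : ∀ g, u1W β g⁻¹ = u1W β g := u1W_symm β
  -- a puncture off `P`
  have hcardU : (Finset.univ : Finset (Site 2 L)).card = L ^ 2 := by
    rw [Finset.card_univ, Fintype.card_fun, ZMod.card, Fintype.card_fin]
  have hcard : P.card < (Finset.univ : Finset (Site 2 L)).card := by rw [hcardU]; omega
  obtain ⟨x₀, -, hx₀⟩ := Finset.exists_mem_notMem_of_card_lt_card hcard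
  have hPsub : P ⊆ Finset.univ.erase x₀ := fun x hx =>
    Finset.mem_erase.mpr ⟨fun h => hx₀ (h ▸ hx), Finset.mem_univ _⟩
  set m := ((Finset.univ.erase x₀) \ P).card with hmdef
  have hm : m = L ^ 2 - 1 - P.card := by
    rw [hmdef, Finset.card_sdiff_of_subset hPsub, Finset.card_erase_of_mem (Finset.mem_univ _), hcardU]
  have hm1 : 1 ≤ m := by rw [hm]; omega
  -- the two-sided level of item 101
  obtain ⟨s, hs0, hs1, hup, hlow⟩ := iterate_two_sided hβ hm1
  have hst : s ≠ ⊤ := ne_top_of_le_ne_top ENNReal.one_ne_top hs1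
  set ρ : ℝ≥0∞ := ENNReal.ofReal (Real.exp (-(β * ((m + 1 : ℝ) * (1 - Real.cos (Real.pi / m))))))
    with hρdef
  have hρeq : ENNReal.ofReal (Real.exp (-(β * (((L ^ 2 - P.card : ℕ) : ℝ) *
      (1 - Real.cos (Real.pi / ((L ^ 2 - P.card - 1 : ℕ) : ℝ))))))) = ρ := by
    have h1 : ((L ^ 2 - P.card : ℕ) : ℝ) = m + 1 := by
      rw [hm, show L ^ 2 - P.card = (L ^ 2 - 1 - P.card) + 1 by omega]; push_cast; ring
    have h2 : ((L ^ 2 - P.card - 1 : ℕ) : ℝ) = m := by rw [hm, show L ^ 2 - P.card - 1 = L ^ 2 - 1 - P.card by omega]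
    rw [h1, h2]
  -- `Z` and the numerator through lean-1's puncture formula
  have hdens : Measurable fun U : GaugeConfig 2 L Circle =>
      ENNReal.ofReal (Real.exp (-β * wilsonAction u1Rep U)) := by
    have h : (fun U : GaugeConfig 2 L Circle => ENNReal.ofReal (Real.exp (-β * wilsonAction u1Rep U))) =
        fun U => ∏ x, u1W β (plaquetteHolonomy U x 0 1) := funext (weight_eq_prod_two u1Rep β)
    rw [h]
    exact Finset.measurable_prod _ fun x _ => hw.comp (measurable_plaquetteHolonomy x)
  have hfhol : Measurable fun U : GaugeConfig 2 L Circle => f (fun x => plaquetteHolonomy U x 0 1) :=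
    hfm.comp (measurable_pi_lambda _ fun x => measurable_plaquetteHolonomy x)
  have hZ : partitionFunction (d := 2) (L := L) u1Rep β =
      ∫⁻ U, (fun _ => (1 : ℝ≥0∞)) (fun x => plaquetteHolonomy U x 0 1) *
        ∏ x, u1W β (plaquetteHolonomy U x 0 1) ∂(Measure.pi fun _ : Edge 2 L => haarProbability Circle) := by
    unfold partitionFunction wilsonWeight
    rw [withDensity_apply _ MeasurableSet.univ, Measure.restrict_univ]
    refine lintegral_congr fun U => ?_
    rw [weight_eq_prod_two u1Rep β U, one_mul]; rfl
  have hZle : partitionFunction (d := 2) (L := L) u1Rep β ≤ s * z1 u1Rep β ^ P.card := by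
    rw [hZ, ← lintegral_prod_u1W_eq_pow β P]
    have h := lintegral_weight_mul_le hL hw hws x₀ P hx₀ (f := fun _ => (1 : ℝ≥0∞)) measurable_const
      (fun _ _ _ => rfl) hup
    simpa only [one_mul] using h
  have hZ0 : partitionFunction (d := 2) (L := L) u1Rep β ≠ 0 := by
    rw [hZ]
    simp only [one_mul]
    rw [lintegral_prod_weight_eq_iterate hL hw hws]
    exact iterate_apply_ne_zero hw (u1W_ne_zero β) _ _
  have hZt : partitionFunction (d := 2) (L := L) u1Rep β ≠ ⊤ :=
    ne_top_of_le_ne_top (ENNReal.mul_ne_top hst (ENNReal.pow_ne_top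
      (ne_top_of_le_ne_top ENNReal.one_ne_top (z1_u1_le_one hβ)))) hZle
  have hnum : ρ * s * ∫⁻ g, f g * ∏ x ∈ P, u1W β (g x) ∂(Measure.pi fun _ : Site 2 L => haarProbability Circle) ≤
      ∫⁻ U, f (fun x => plaquetteHolonomy U x 0 1) * ∏ x, u1W β (plaquetteHolonomy U x 0 1)
        ∂(Measure.pi fun _ : Edge 2 L => haarProbability Circle) := by
    rw [lintegral_weight_mul_eq_iterate hL hw hws x₀ P hx₀ hfm hf,
      ← lintegral_const_mul' _ _ (ENNReal.mul_ne_top ENNReal.ofReal_ne_top hst)]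
    refine lintegral_mono fun g => ?_
    rw [mul_comm (ρ * s)]
    exact mul_le_mul_right (hlow _) _
  -- the Wilson integral as `Z⁻¹ · numerator`
  have hint : ∫⁻ U, f (fun x => plaquetteHolonomy U x 0 1) ∂(wilsonMeasure (d := 2) (L := L) u1Rep β) =
      (partitionFunction (d := 2) (L := L) u1Rep β)⁻¹ *
        ∫⁻ U, f (fun x => plaquetteHolonomy U x 0 1) * ∏ x, u1W β (plaquetteHolonomy U x 0 1)
          ∂(Measure.pi fun _ : Edge 2 L => haarProbability Circle) := by
    unfold wilsonMeasure
    rw [lintegral_smul_measure]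
    congr 1
    unfold wilsonWeight
    rw [lintegral_withDensity_eq_lintegral_mul _ hdens hfhol]
    refine lintegral_congr fun U => ?_
    rw [Pi.mul_apply, weight_eq_prod_two u1Rep β U, mul_comm]; rfl
  -- assemble: `ρ I = z₁^#P (s z₁^#P)⁻¹ (ρ s I) ≤ z₁^#P Z⁻¹ N`
  rw [hρeq, hint]
  set I := ∫⁻ g, f g * ∏ x ∈ P, u1W β (g x) ∂(Measure.pi fun _ : Site 2 L => haarProbability Circle)
  set Z := partitionFunction (d := 2) (L := L) u1Rep β
  have hz0 : z1 u1Rep β ^ P.card ≠ 0 := pow_ne_zero _ (z1_u1_ne_zero β)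
  have hzt : z1 u1Rep β ^ P.card ≠ ⊤ :=
    ENNReal.pow_ne_top (ne_top_of_le_ne_top ENNReal.one_ne_top (z1_u1_le_one hβ))
  calc ρ * I = z1 u1Rep β ^ P.card * ((s * z1 u1Rep β ^ P.card)⁻¹ * (ρ * s * I)) := by
        rw [ENNReal.mul_inv (Or.inl hs0) (Or.inl hst)]
        calc ρ * I = (z1 u1Rep β ^ P.card * (z1 u1Rep β ^ P.card)⁻¹) * (s⁻¹ * s) * (ρ * I) := by
              rw [ENNReal.mul_inv_cancel hz0 hzt, ENNReal.inv_mul_cancel hs0 hst, one_mul, one_mul]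
          _ = _ := by ring
    _ ≤ z1 u1Rep β ^ P.card * (Z⁻¹ * ∫⁻ U, f (fun x => plaquetteHolonomy U x 0 1) *
          ∏ x, u1W β (plaquetteHolonomy U x 0 1) ∂(Measure.pi fun _ : Edge 2 L => haarProbability Circle)) := by
        exact mul_le_mul_right (mul_le_mul' (ENNReal.inv_le_inv.mpr hZle) hnum) _

/-- **EVENT FORM**: for a measurable `B ⊆ U(1)^Λ` determined by the coordinates in `P`,
`e^{−β(L²−#P)(1−cos(π/(L²−#P−1)))}·∫ 1_B·∏_{x∈P} w_β dHaar^{⊗Λ} ≤ z₁(β)^{#P}·μ_{β,L}{U_· ∈ B}`. [folklore] -/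
theorem u1_measure_patch_ge [NeZero L] (hL : 2 ≤ L) {β : ℝ} (hβ : 0 ≤ β) (P : Finset (Site 2 L))
    (hP : P.card + 3 ≤ L ^ 2) {B : Set (Site 2 L → Circle)} (hBm : MeasurableSet B)
    (hB : ∀ g g' : Site 2 L → Circle, (∀ x ∈ P, g x = g' x) → (g ∈ B ↔ g' ∈ B)) :
    ENNReal.ofReal (Real.exp (-(β * (((L ^ 2 - P.card : ℕ) : ℝ) *
        (1 - Real.cos (Real.pi / ((L ^ 2 - P.card - 1 : ℕ) : ℝ))))))) *
      ∫⁻ g, B.indicator 1 g * ∏ x ∈ P, u1W β (g x) ∂(Measure.pi fun _ : Site 2 L => haarProbability Circle) ≤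
    z1 u1Rep β ^ P.card *
      wilsonMeasure (d := 2) (L := L) u1Rep β {U | (fun x => plaquetteHolonomy U x 0 1) ∈ B} := by
  have hind : ∀ g g' : Site 2 L → Circle, (∀ x ∈ P, g x = g' x) →
      B.indicator (1 : (Site 2 L → Circle) → ℝ≥0∞) g = B.indicator 1 g' := by
    intro g g' h
    by_cases hg : g ∈ B
    · rw [Set.indicator_of_mem hg, Set.indicator_of_mem ((hB g g' h).mp hg), Pi.one_apply, Pi.one_apply]
    · rw [Set.indicator_of_notMem hg, Set.indicator_of_notMem (fun h' => hg ((hB g g' h).mpr h'))]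
  have h := u1_lintegral_patch_ge hL hβ P hP (measurable_one.indicator hBm) hind
  have hset : MeasurableSet {U : GaugeConfig 2 L Circle | (fun x => plaquetteHolonomy U x 0 1) ∈ B} :=
    hBm.preimage (measurable_pi_lambda _ fun x => measurable_plaquetteHolonomy x)
  rwa [← lintegral_indicator_one hset, show (fun U : GaugeConfig 2 L Circle =>
      {U : GaugeConfig 2 L Circle | (fun x => plaquetteHolonomy U x 0 1) ∈ B}.indicator 1 U) =
      fun U => B.indicator 1 (fun x => plaquetteHolonomy U x 0 1) from by
    funext U; simp only [Set.indicator, Set.mem_setOf_eq]; rfl] 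

end Summit.Ventures.LatticeQCDFlow.Theory2.Lattice.TwoDim

end
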